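import Mathlib.Analysis.Calculus.BumpFunction.InnerProduct
import Mathlib.Analysis.Calculus.BumpFunction.FiniteDimension
import Mathlib.Analysis.SpecialFunctions.ImproperIntegrals
import Mathlib.MeasureTheory.Integral.IntegralEqImproper
import Literature.Analysis.FunctionSpaces.KMSStatesGroundStateProofs
import HarnessLib

/-!
# The weight function of the quasi-adiabatic (spectral-flow) generator

The quasi-adiabatic continuation / spectral flow of Hastings (Phys. Rev. B **69** (2004) 104431,
§II) and Hastings–Wen (Phys. Rev. B **72** (2005) 045141), in the form given by
Bachmann–Michalakis–Nachtergaele–Sims, *Automorphic equivalence within gapped phases of quantum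
lattice systems*, Comm. Math. Phys. **309** (2012) 835–871 (BMNS), §2, is generated by
`D = ∫ W_γ(t) e^{itH} H' e^{-itH} dt` (BMNS Corollary 2.8) for an odd weight function
`W_γ ∈ L¹(ℝ)` (BMNS eq. (2.12), Lemma 2.6) built from a real kernel `w_γ` with `∫ w_γ = 1` whose
Fourier transform is supported in `[-γ, γ]` (BMNS Assumption 2.2); the one property of `W_γ` that
drives the exact intertwining `[A - i∫W_γ(t) τ_t([A,H]) dt, P] = 0` across a spectral gap `≥ γ`
(BMNS Proposition 2.4; Bachmann–De Roeck–Fraas CMP **361** (2018) Prop. 4.1, used in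
Bachmann–Bols–De Roeck–Fraas CMP **375** (2019) Prop. 2.4) is
`∫ W_γ(t) e^{itν} dt = i/ν` for all `|ν| ≥ γ`.

This file constructs such a weight and PROVES its properties (theorems only, no named facts):

* `qaBump`, `qaSymbol`: a smooth even frequency cut-off `ρ` (`= 1` near `0`, `= 0` for
  `|ξ| ≥ 1/(2π)`) as a Schwartz symbol; `qaKernel = Re 𝓕ρ` the kernel `w = w₁` (real, even,
  Schwartz: `qaKernel_decay`; `∫ w = 1`, `∫ w(t) cos(νt) dt = ρ(ν/2π)`, which vanishes for
  `|ν| ≥ 1`: `integral_qaKernel_mul_cos_eq_zero` — BMNS Assumption 2.2 at `γ = 1`).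
* `qaTail t = ∫_{s>t} w`, `qaWeightOne t = sign(t) · qaTail |t|` (`= W₁`, BMNS eq. (2.12)) and the
  scaling `qaWeight γ t = W₁(γt)` (`= W_γ`): odd (`qaWeight_neg`), bounded uniformly in `γ`
  (`abs_qaWeight_le`), integrable with `∫|W_γ| = ‖W₁‖₁/γ` (`integral_abs_qaWeight`, BMNS
  Lemma 2.6 (iii)), with super-polynomially small tails
  `∫_{|t|>T} |W_γ| ≤ 2C_n γ⁻¹ (1+γT)^{-(n+1)}` for every `n` (`integral_abs_qaWeight_tail`).
* The exact Fourier property: `∫ W_γ(t) sin(νt) dt = 1/ν`, `∫ W_γ(t) cos(νt) dt = 0` and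
  `∫ W_γ(t) e^{itν} dt = i/ν` for `|ν| ≥ γ > 0` (`integral_qaWeight_mul_sin`,
  `integral_qaWeight_mul_cos`, `integral_qaWeight_mul_cexp`), by integration by parts on
  `(0, ∞)` (`integral_Ioi_qaTail_mul_sin`) and Fourier inversion for the Schwartz symbol.

Design choice (deliberately NOT BMNS's Lemma 2.3): BMNS take for `w_γ` an infinite product of
`sinc²` factors with almost-exponential decay `e^{-(2/7)γt/ln²(γt)}`; here `w₁ = 𝓕ρ` for a
compactly supported smooth `ρ`, which is Schwartz (Mathlib), so all tails are `O(T^{-n})` for every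
`n` — exactly what the `O(L^{-∞})` locality estimates of the generator require — at a fraction of
the special-function cost. The explicit BMNS decay rates are not reproduced.

## References

* S. Bachmann, S. Michalakis, B. Nachtergaele, R. Sims, Comm. Math. Phys. **309** (2012) 835–871,
  §2: Assumption 2.2, Proposition 2.4, eq. (2.12), Lemma 2.6, Corollary 2.8.
  [BachmannMichalakisNachtergaeleSimsCMP2012]
* M. B. Hastings, Phys. Rev. B **69** (2004) 104431, §II. [HastingsPRB2004]
* M. B. Hastings, X.-G. Wen, Phys. Rev. B **72** (2005) 045141. [HastingsWen2005]
* S. Bachmann, A. Bols, W. De Roeck, M. Fraas, Comm. Math. Phys. **375** (2019) 1249, Prop. 2.4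
  (the map `𝓘` in the proof of local charge fluctuations). [BachmannEtAl2019]
* Mathlib: `ContDiffBump`, `HasCompactSupport.toSchwartzMap`, `SchwartzMap.decay`,
  `Real.fourierInv_eq_fourier_neg`, `Continuous.fourierInv_fourier_eq` (via the tree's
  `Literature.Analysis.FunctionSpaces.fourierInv_fourier_schwartz_apply`), `integral_comp_abs`,
  `integral_Ioi_of_hasDerivAt_of_tendsto'`, `Measure.integral_comp_mul_left`,
  `integral_comp_mul_left_Ioi`.
-/

noncomputable section

open Real Complex Set Filter MeasureTheory SchwartzMap
open Literature.Analysis.FunctionSpaces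
open scoped Topology FourierTransform ContDiff ComplexConjugate

namespace Literature.MathematicalPhysics.QuantumLattice

/-- The frequency cut-off `ρ`: a smooth even bump on `ℝ`, `ρ = 1` on `|ξ| ≤ 1/(4π)`, `ρ = 0` on
`|ξ| ≥ 1/(2π)`, `0 ≤ ρ ≤ 1`. [folklore] -/
def qaBump : ContDiffBump (0 : ℝ) where
  rIn := 1 / (4 * π)
  rOut := 1 / (2 * π)
  rIn_pos := by positivity
  rIn_lt_rOut := by
    rw [one_div_lt_one_div (by positivity) (by positivity)]
    nlinarith [Real.pi_pos]

/-- The cut-off as a complex-valued function. [folklore] -/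
def qaBumpC (ξ : ℝ) : ℂ := (qaBump ξ : ℂ)

/-- The complex cut-off is smooth. [folklore] -/
theorem contDiff_qaBumpC : ContDiff ℝ ∞ qaBumpC :=
  ofRealCLM.contDiff.comp qaBump.contDiff

/-- The complex cut-off has compact support. [folklore] -/
theorem hasCompactSupport_qaBumpC : HasCompactSupport qaBumpC :=
  qaBump.hasCompactSupport.comp_left (g := fun x : ℝ => (x : ℂ)) (by simp)

/-- The cut-off as a Schwartz symbol. [folklore] -/
def qaSymbol : 𝓢(ℝ, ℂ) := hasCompactSupport_qaBumpC.toSchwartzMap contDiff_qaBumpC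

/-- Values of the Schwartz symbol. [folklore] -/
@[simp] theorem qaSymbol_apply (ξ : ℝ) : qaSymbol ξ = (qaBump ξ : ℂ) := rfl

/-- The cut-off is even. [folklore] -/
theorem qaBump_neg (ξ : ℝ) : qaBump (-ξ) = qaBump ξ := qaBump.neg ξ

/-- The cut-off equals `1` at the origin. [folklore] -/
theorem qaBump_zero : qaBump 0 = 1 :=
  qaBump.one_of_mem_closedBall (by simp [qaBump.rIn_pos.le])

/-- The cut-off vanishes for `|ξ| ≥ 1/(2π)`. [folklore] -/
theorem qaBump_eq_zero {ξ : ℝ} (h : 1 / (2 * π) ≤ |ξ|) : qaBump ξ = 0 :=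
  qaBump.zero_of_le_dist (by simpa [qaBump] using h)

/-- The kernel `w = Re 𝓕ρ`. [folklore] -/
def qaKernel (t : ℝ) : ℝ := (𝓕 (qaSymbol : ℝ → ℂ) t).re

/-- Complex conjugation of a Fourier integral on `ℝ`: `conj (𝓕 f t) = 𝓕⁻ (conj ∘ f) t`.
[folklore] -/
theorem conj_fourier_real (f : ℝ → ℂ) (t : ℝ) :
    conj (𝓕 f t) = 𝓕⁻ (fun v => conj (f v)) t := by
  rw [Real.fourier_real_eq_integral_exp_smul, fourierInv_real_eq_integral_exp_smul,
    ← integral_conj]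
  refine congrArg (fun F : ℝ → ℂ => ∫ v, F v) (funext fun v => ?_)
  simp only [smul_eq_mul, map_mul, ← Complex.exp_conj, conj_ofReal, conj_I, mul_neg]
  congr 2
  push_cast
  ring

/-- `𝓕ρ` is even. [folklore] -/
theorem fourier_qaSymbol_neg (t : ℝ) :
    𝓕 (qaSymbol : ℝ → ℂ) (-t) = 𝓕 (qaSymbol : ℝ → ℂ) t := by
  rw [← Real.fourierInv_eq_fourier_neg, Real.fourierInv_eq_fourier_comp_neg]
  refine congrArg (fun F : ℝ → ℂ => 𝓕 F t) (funext fun v => ?_)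
  simp [qaBump_neg]

/-- `𝓕ρ` is real: `conj (𝓕ρ t) = 𝓕ρ t`. [folklore] -/
theorem conj_fourier_qaSymbol (t : ℝ) :
    conj (𝓕 (qaSymbol : ℝ → ℂ) t) = 𝓕 (qaSymbol : ℝ → ℂ) t := by
  rw [conj_fourier_real, Real.fourierInv_eq_fourier_neg, ← fourier_qaSymbol_neg t]
  refine congrArg (fun F : ℝ → ℂ => 𝓕 F (-t)) (funext fun v => ?_)
  simp

/-- `𝓕ρ = w` (as a complex number). [folklore] -/
theorem fourier_qaSymbol_eq (t : ℝ) : 𝓕 (qaSymbol : ℝ → ℂ) t = (qaKernel t : ℂ) := by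
  rw [qaKernel]
  exact (Complex.conj_eq_iff_re.1 (conj_fourier_qaSymbol t)).symm

/-- The kernel is even. [folklore] -/
theorem qaKernel_neg (t : ℝ) : qaKernel (-t) = qaKernel t := by
  rw [qaKernel, qaKernel, fourier_qaSymbol_neg]

/-- The kernel is continuous. [folklore] -/
theorem continuous_qaKernel : Continuous qaKernel :=
  Complex.continuous_re.comp (continuous_fourier_schwartz qaSymbol)

/-- The kernel is integrable. [folklore] -/
theorem integrable_qaKernel : Integrable qaKernel := by
  have h := (integrable_fourier_schwartz qaSymbol).re
  exact h

/-- `|w t| = ‖𝓕ρ t‖`. [folklore] -/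
theorem abs_qaKernel_eq (t : ℝ) : |qaKernel t| = ‖𝓕 (qaSymbol : ℝ → ℂ) t‖ := by
  rw [fourier_qaSymbol_eq, Complex.norm_real, Real.norm_eq_abs]

/-- **Rapid decay of the kernel**: `(1 + |t|)^k |w(t)| ≤ C_k` (the Fourier transform of a Schwartz
function is Schwartz). [folklore] -/
theorem qaKernel_decay (k : ℕ) : ∃ C : ℝ, 0 < C ∧ ∀ t : ℝ, (1 + |t|) ^ k * |qaKernel t| ≤ C := by
  set g : 𝓢(ℝ, ℂ) := 𝓕 qaSymbol with hg
  obtain ⟨C₀, hC₀, h₀⟩ := g.decay 0 0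
  obtain ⟨C₁, hC₁, h₁⟩ := g.decay k 0
  refine ⟨2 ^ k * (C₀ + C₁), by positivity, fun t => ?_⟩
  have e : ∀ x : ℝ, ‖iteratedFDeriv ℝ 0 (⇑g) x‖ = |qaKernel x| := fun x => by
    rw [norm_iteratedFDeriv_zero, abs_qaKernel_eq, hg, SchwartzMap.fourier_coe]
  have h₀' : |qaKernel t| ≤ C₀ := by simpa [e] using h₀ t
  have h₁' : |t| ^ k * |qaKernel t| ≤ C₁ := by simpa [e, Real.norm_eq_abs] using h₁ t
  have hk : (1 + |t|) ^ k ≤ 2 ^ k * (1 + |t| ^ k) := by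
    rcases le_total |t| 1 with h | h
    · calc (1 + |t|) ^ k ≤ (1 + 1) ^ k := by gcongr
        _ = 2 ^ k * 1 := by norm_num
        _ ≤ 2 ^ k * (1 + |t| ^ k) := by gcongr; linarith [pow_nonneg (abs_nonneg t) k]
    · calc (1 + |t|) ^ k ≤ (|t| + |t|) ^ k := by gcongr
        _ = 2 ^ k * |t| ^ k := by rw [← two_mul, mul_pow]
        _ ≤ 2 ^ k * (1 + |t| ^ k) := by gcongr; linarith
  calc (1 + |t|) ^ k * |qaKernel t| ≤ 2 ^ k * (1 + |t| ^ k) * |qaKernel t| := by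
        gcongr
    _ = 2 ^ k * (|qaKernel t| + |t| ^ k * |qaKernel t|) := by ring
    _ ≤ 2 ^ k * (C₀ + C₁) := by gcongr

/-- Pointwise form of the decay: `|w(t)| ≤ C_k / (1 + |t|)^k`. [folklore] -/
theorem abs_qaKernel_le (k : ℕ) : ∃ C : ℝ, 0 < C ∧ ∀ t : ℝ, |qaKernel t| ≤ C / (1 + |t|) ^ k := by
  obtain ⟨C, hC, h⟩ := qaKernel_decay k
  refine ⟨C, hC, fun t => ?_⟩
  rw [le_div_iff₀ (by positivity), mul_comm]
  exact h t

/-- **Fourier inversion for the kernel**: `∫ w(t) cos(ν t) dt = ρ(ν/2π)`. [folklore] -/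
theorem integral_qaKernel_mul_cos (ν : ℝ) :
    ∫ t, qaKernel t * Real.cos (ν * t) = qaBump (ν / (2 * π)) := by
  have hinv := fourierInv_fourier_schwartz_apply qaSymbol (ν / (2 * π))
  rw [fourierInv_real_eq_integral_exp_smul] at hinv
  simp only [fourier_qaSymbol_eq, smul_eq_mul, qaSymbol_apply] at hinv
  -- integrand: `e^{2πi t ξ} w(t)` with real part `cos(ν t) w(t)`
  have hint : Integrable fun v : ℝ => cexp (↑(2 * π * v * (ν / (2 * π))) * I) * (qaKernel v : ℂ) := by
    have hc : Continuous fun v : ℝ => cexp (↑(2 * π * v * (ν / (2 * π))) * I) * (qaKernel v : ℂ) := by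
      have := continuous_qaKernel
      fun_prop
    refine integrable_qaKernel.abs.mono' hc.aestronglyMeasurable
      (Eventually.of_forall fun v => le_of_eq ?_)
    rw [norm_mul, norm_exp_ofReal_mul_I, one_mul, Complex.norm_real, Real.norm_eq_abs]
  have hre := congrArg Complex.re hinv
  have hre2 : ∫ v, (cexp (↑(2 * π * v * (ν / (2 * π))) * I) * (qaKernel v : ℂ)).re =
      (∫ v, cexp (↑(2 * π * v * (ν / (2 * π))) * I) * (qaKernel v : ℂ)).re := by
    simpa using integral_re hint
  rw [← hre2] at hre
  simp only [ofReal_re] at hre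
  rw [← hre]
  refine congrArg (fun F : ℝ → ℝ => ∫ v, F v) (funext fun v => ?_)
  have e : 2 * π * v * (ν / (2 * π)) = ν * v := by field_simp
  rw [e, mul_comm, Complex.re_mul_ofReal, exp_ofReal_mul_I_re]

/-- The kernel has integral one. [folklore] -/
theorem integral_qaKernel : ∫ t, qaKernel t = 1 := by
  have h := integral_qaKernel_mul_cos 0
  simpa [qaBump_zero] using h

/-- The cosine transform of the kernel vanishes for `|ν| ≥ 1` (the cut-off has Fourier support in
`|ξ| < 1/(2π)`). [folklore] -/
theorem integral_qaKernel_mul_cos_eq_zero {ν : ℝ} (hν : 1 ≤ |ν|) :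
    ∫ t, qaKernel t * Real.cos (ν * t) = 0 := by
  rw [integral_qaKernel_mul_cos, qaBump_eq_zero]
  rw [abs_div, abs_of_pos (by positivity : (0:ℝ) < 2 * π), le_div_iff₀ (by positivity)]
  calc 1 / (2 * π) * (2 * π) = 1 := by field_simp
    _ ≤ |ν| := hν


/-! ### A calculus lemma: `∫_{s>t} (1+s)^{-(n+2)} ds` -/

/-- `∫_{s > t} (1+s)^{-(n+2)} ds = (1+t)^{-(n+1)}/(n+1)` for `t ≥ 0`, with integrability. [folklore] -/
theorem integral_Ioi_inv_one_add_pow {t : ℝ} (ht : 0 ≤ t) (n : ℕ) :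
    IntegrableOn (fun s : ℝ => ((1 + s) ^ (n + 2))⁻¹) (Ioi t) ∧
      ∫ s in Ioi t, ((1 + s) ^ (n + 2))⁻¹ = ((1 + t) ^ (n + 1))⁻¹ / (n + 1) := by
  set G : ℝ → ℝ := fun s => -(((1 + s) ^ (n + 1))⁻¹ / (n + 1)) with hG
  have hderiv : ∀ s ∈ Ici t, HasDerivAt G (((1 + s) ^ (n + 2))⁻¹) s := by
    intro s hs
    have hs1 : (0 : ℝ) < 1 + s := by linarith [show t ≤ s from hs]
    have hp : HasDerivAt (fun y : ℝ => (1 + y) ^ (n + 1)) (↑(n + 1) * (1 + s) ^ n * 1) s :=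
      ((hasDerivAt_id s).const_add 1).pow (n + 1)
    have hinv := (hp.inv (pow_ne_zero _ hs1.ne')).div_const ((n : ℝ) + 1) |>.neg
    refine hinv.congr_deriv ?_
    have hn : ((n : ℝ) + 1) ≠ 0 := by positivity
    field_simp
    push_cast
    ring
  have hpos : ∀ s ∈ Ioi t, (0 : ℝ) ≤ ((1 + s) ^ (n + 2))⁻¹ := fun s hs => by
    have : (0 : ℝ) < 1 + s := by linarith [show t < s from hs]
    positivity
  have hlim : Tendsto G atTop (𝓝 (-(0 / ((n : ℝ) + 1)))) := by
    refine Tendsto.neg (Tendsto.div_const ?_ _)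
    refine tendsto_inv_atTop_zero.comp ?_
    exact (tendsto_pow_atTop (by omega)).comp (tendsto_atTop_add_const_left _ _ tendsto_id)
  refine ⟨integrableOn_Ioi_deriv_of_nonneg' hderiv hpos hlim, ?_⟩
  rw [integral_Ioi_of_hasDerivAt_of_nonneg' hderiv hpos hlim, hG]
  ring

/-! ### The tail integral `F(t) = ∫_{s>t} w(s) ds` -/

/-- The tail `F(t) = ∫_{s > t} w(s) ds` of the kernel. [folklore] -/
def qaTail (t : ℝ) : ℝ := ∫ s in Ioi t, qaKernel s

/-- `F(t) = ∫_{s>0} w - ∫₀ᵗ w`. [folklore] -/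
theorem qaTail_eq_sub (t : ℝ) :
    qaTail t = (∫ s in Ioi 0, qaKernel s) - ∫ s in (0:ℝ)..t, qaKernel s := by
  have h := intervalIntegral.integral_Ioi_sub_Ioi' (integrable_qaKernel.integrableOn (s := Ioi 0))
    (integrable_qaKernel.integrableOn (s := Ioi t))
  rw [qaTail]
  linarith

/-- `F' = -w`. [folklore] -/
theorem hasDerivAt_qaTail (t : ℝ) : HasDerivAt qaTail (-qaKernel t) t := by
  have h := (continuous_qaKernel.integral_hasStrictDerivAt 0 t).hasDerivAt
  have e : qaTail = fun u => (∫ s in Ioi 0, qaKernel s) - ∫ s in (0:ℝ)..u, qaKernel s :=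
    funext qaTail_eq_sub
  rw [e]
  exact h.const_sub _

/-- `F` is continuous. [folklore] -/
theorem continuous_qaTail : Continuous qaTail :=
  continuous_iff_continuousAt.2 fun t => (hasDerivAt_qaTail t).continuousAt

/-- `∫_{s>0} w = 1/2` (the kernel is even with integral one). [folklore] -/
theorem integral_Ioi_qaKernel : ∫ s in Ioi 0, qaKernel s = 1 / 2 := by
  have h := integral_comp_abs (f := qaKernel)
  have e : (fun x : ℝ => qaKernel |x|) = qaKernel := by
    funext x
    rcases le_total 0 x with hx | hx
    · rw [abs_of_nonneg hx]
    · rw [abs_of_nonpos hx, qaKernel_neg]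
  rw [e, integral_qaKernel] at h
  linarith

/-- `F(0) = 1/2`. [folklore] -/
theorem qaTail_zero : qaTail 0 = 1 / 2 := integral_Ioi_qaKernel

/-- The global bound `|F(t)| ≤ ∫ |w|`. [folklore] -/
theorem abs_qaTail_le (t : ℝ) : |qaTail t| ≤ ∫ s, |qaKernel s| := by
  rw [qaTail]
  refine (abs_integral_le_integral_abs).trans ?_
  exact setIntegral_le_integral integrable_qaKernel.abs (Eventually.of_forall fun s => abs_nonneg _)

/-- **Decay of the tail**: `|F(t)| ≤ C_n (1+t)^{-(n+1)}` for `t ≥ 0`. [folklore] -/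
theorem abs_qaTail_le_of_nonneg (n : ℕ) :
    ∃ C : ℝ, 0 < C ∧ ∀ t : ℝ, 0 ≤ t → |qaTail t| ≤ C / (1 + t) ^ (n + 1) := by
  obtain ⟨C, hC, hw⟩ := abs_qaKernel_le (n + 2)
  refine ⟨C / (n + 1), by positivity, fun t ht => ?_⟩
  obtain ⟨hint, hval⟩ := integral_Ioi_inv_one_add_pow ht n
  calc |qaTail t| ≤ ∫ s in Ioi t, |qaKernel s| := abs_integral_le_integral_abs
    _ ≤ ∫ s in Ioi t, C * ((1 + s) ^ (n + 2))⁻¹ := by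
        refine setIntegral_mono_on integrable_qaKernel.abs.integrableOn (hint.const_mul C)
          measurableSet_Ioi fun s hs => ?_
        have hs0 : 0 ≤ s := ht.trans (le_of_lt hs)
        have := hw s
        rw [abs_of_nonneg hs0] at this
        rwa [← div_eq_mul_inv]
    _ = C * (((1 + t) ^ (n + 1))⁻¹ / (n + 1)) := by rw [integral_const_mul, hval]
    _ = C / (n + 1) / (1 + t) ^ (n + 1) := by
        field_simp

/-- `F(t) → 0` as `t → ∞`. [folklore] -/
theorem tendsto_qaTail_atTop : Tendsto qaTail atTop (𝓝 0) := by
  obtain ⟨C, hC, h⟩ := abs_qaTail_le_of_nonneg 0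
  have hg : Tendsto (fun t : ℝ => C * (1 + t)⁻¹) atTop (𝓝 (C * 0)) :=
    (tendsto_inv_atTop_zero.comp (tendsto_atTop_add_const_left _ _ tendsto_id)).const_mul C
  rw [mul_zero] at hg
  refine squeeze_zero_norm' ?_ hg
  filter_upwards [eventually_ge_atTop (0:ℝ)] with t ht
  rw [Real.norm_eq_abs]
  have := h t ht
  rwa [zero_add, pow_one, div_eq_mul_inv] at this

/-- **Integrability and tails of `F` on half-lines**: `∫_{t>T} |F(t)| dt ≤ C_n (1+T)^{-(n+1)}`.
[folklore] -/
theorem integral_Ioi_abs_qaTail_le (n : ℕ) :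
    ∃ C : ℝ, 0 < C ∧ ∀ T : ℝ, 0 ≤ T → IntegrableOn qaTail (Ioi T) ∧
      ∫ t in Ioi T, |qaTail t| ≤ C / (1 + T) ^ (n + 1) := by
  obtain ⟨C, hC, hF⟩ := abs_qaTail_le_of_nonneg (n + 1)
  refine ⟨C / (n + 1), by positivity, fun T hT => ?_⟩
  obtain ⟨hint, hval⟩ := integral_Ioi_inv_one_add_pow hT n
  have hbd : ∀ t ∈ Ioi T, |qaTail t| ≤ C * ((1 + t) ^ (n + 2))⁻¹ := fun t ht => by
    rw [← div_eq_mul_inv]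
    exact hF t (hT.trans (le_of_lt ht))
  have hFint : IntegrableOn qaTail (Ioi T) := by
    refine Integrable.mono' (hint.const_mul C) continuous_qaTail.aestronglyMeasurable ?_
    refine (ae_restrict_iff' measurableSet_Ioi).2 (Eventually.of_forall fun t ht => ?_)
    rw [Real.norm_eq_abs]
    exact hbd t ht
  refine ⟨hFint, ?_⟩
  calc ∫ t in Ioi T, |qaTail t| ≤ ∫ t in Ioi T, C * ((1 + t) ^ (n + 2))⁻¹ :=
        setIntegral_mono_on hFint.abs (hint.const_mul C) measurableSet_Ioi hbd
    _ = C * (((1 + T) ^ (n + 1))⁻¹ / (n + 1)) := by rw [integral_const_mul, hval]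
    _ = C / (n + 1) / (1 + T) ^ (n + 1) := by field_simp

/-- `F` is integrable on `(0, ∞)`. [folklore] -/
theorem integrableOn_qaTail_Ioi : IntegrableOn qaTail (Ioi 0) := by
  obtain ⟨C, -, h⟩ := integral_Ioi_abs_qaTail_le 0
  exact (h 0 le_rfl).1

/-- Half of the cosine transform: `∫_{t>0} w(t) cos(νt) dt = ρ(ν/2π)/2`. [folklore] -/
theorem integral_Ioi_qaKernel_mul_cos (ν : ℝ) :
    ∫ t in Ioi 0, qaKernel t * Real.cos (ν * t) = qaBump (ν / (2 * π)) / 2 := by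
  have h := integral_comp_abs (f := fun t => qaKernel t * Real.cos (ν * t))
  have e : (fun x : ℝ => qaKernel |x| * Real.cos (ν * |x|)) = fun x => qaKernel x * Real.cos (ν * x) := by
    funext x
    rcases le_total 0 x with hx | hx
    · rw [abs_of_nonneg hx]
    · rw [abs_of_nonpos hx, qaKernel_neg, mul_neg, Real.cos_neg]
  simp only [e, integral_qaKernel_mul_cos] at h
  linarith

/-- **The sine transform of the tail** (integration by parts on `(0, ∞)`):
`∫_{t>0} F(t) sin(νt) dt = (1 - ρ(ν/2π)) / (2ν)` for `ν ≠ 0`. [folklore] -/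
theorem integral_Ioi_qaTail_mul_sin {ν : ℝ} (hν : ν ≠ 0) :
    ∫ t in Ioi 0, qaTail t * Real.sin (ν * t) = (1 - qaBump (ν / (2 * π))) / (2 * ν) := by
  set f : ℝ → ℝ := fun t => -(qaTail t * Real.cos (ν * t)) / ν with hf
  set f' : ℝ → ℝ := fun t => qaTail t * Real.sin (ν * t) + qaKernel t * Real.cos (ν * t) / ν
    with hf'
  have hderiv : ∀ t ∈ Ici (0:ℝ), HasDerivAt f (f' t) t := by
    intro t _
    have hc : HasDerivAt (fun y : ℝ => Real.cos (ν * y)) (-Real.sin (ν * t) * (ν * 1)) t :=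
      ((hasDerivAt_id t).const_mul ν).cos
    have h := (((hasDerivAt_qaTail t).mul hc).neg).div_const ν
    refine h.congr_deriv ?_
    simp only [hf']
    field_simp
    ring
  have hsin_int : IntegrableOn (fun t => qaTail t * Real.sin (ν * t)) (Ioi 0) := by
    refine integrableOn_qaTail_Ioi.mul_bdd (c := 1) (by fun_prop) ?_
    exact Eventually.of_forall fun t => by simpa using Real.abs_sin_le_one (ν * t)
  have hcos_int : Integrable (fun t => qaKernel t * Real.cos (ν * t)) := by
    refine integrable_qaKernel.mul_bdd (c := 1) (by fun_prop) ?_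
    exact Eventually.of_forall fun t => by simpa using Real.abs_cos_le_one (ν * t)
  have hint : IntegrableOn f' (Ioi 0) := by
    simp only [hf']
    exact hsin_int.add (hcos_int.div_const ν).integrableOn
  have hlim : Tendsto f atTop (𝓝 0) := by
    have hg : Tendsto (fun t : ℝ => |qaTail t| / |ν|) atTop (𝓝 0) := by
      have := (tendsto_qaTail_atTop.abs).div_const |ν|
      simpa using this
    refine squeeze_zero_norm (fun t => ?_) hg
    rw [hf, Real.norm_eq_abs, abs_div, abs_neg, abs_mul]
    gcongr
    exact mul_le_of_le_one_right (abs_nonneg _) (Real.abs_cos_le_one _)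
  have hFTC := integral_Ioi_of_hasDerivAt_of_tendsto' hderiv hint hlim
  have hf0 : f 0 = -(1 / 2) / ν := by simp [hf, qaTail_zero]
  rw [hf0] at hFTC
  -- split the integral of `f'`
  have hsplit : ∫ t in Ioi 0, f' t = (∫ t in Ioi 0, qaTail t * Real.sin (ν * t)) +
      (∫ t in Ioi 0, qaKernel t * Real.cos (ν * t)) / ν := by
    simp only [hf']
    rw [integral_add hsin_int (hcos_int.div_const ν).integrableOn, integral_div]
  rw [hsplit, integral_Ioi_qaKernel_mul_cos] at hFTC
  field_simp at hFTC ⊢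
  linarith


/-! ### The weight `W₁(t) = sign(t) F(|t|)` -/

/-- The (un-scaled) weight function `W₁(t) = sign(t) F(|t|)`: odd, with `W₁(0±) = ±1/2`. [folklore] -/
def qaWeightOne (t : ℝ) : ℝ := Real.sign t * qaTail |t|

/-- `W₁` is odd. [folklore] -/
theorem qaWeightOne_neg (t : ℝ) : qaWeightOne (-t) = -qaWeightOne t := by
  simp [qaWeightOne, Real.sign_neg, abs_neg]

/-- `W₁ = F` on `(0, ∞)`. [folklore] -/
theorem qaWeightOne_of_pos {t : ℝ} (ht : 0 < t) : qaWeightOne t = qaTail t := by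
  rw [qaWeightOne, Real.sign_of_pos ht, one_mul, abs_of_pos ht]

/-- `W₁(0) = 0`. [folklore] -/
theorem qaWeightOne_zero : qaWeightOne 0 = 0 := by simp [qaWeightOne, Real.sign_zero]

/-- `|W₁(t)| ≤ |F(|t|)|`. [folklore] -/
theorem abs_qaWeightOne_le (t : ℝ) : |qaWeightOne t| ≤ |qaTail (|t|)| := by
  rw [qaWeightOne, abs_mul]
  rcases Real.sign_apply_eq t with h | h | h <;> simp [h]

/-- The uniform bound `|W₁(t)| ≤ ∫ |w|`. [folklore] -/
theorem abs_qaWeightOne_le_integral (t : ℝ) : |qaWeightOne t| ≤ ∫ s, |qaKernel s| :=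
  (abs_qaWeightOne_le t).trans (abs_qaTail_le _)

/-- `W₁` is measurable (`Real.sign` is a measurable step function; cf. the tree's
`Literature.Analysis.FunctionSpaces.BMOInv.measurable_real_sign`, not imported here). [folklore] -/
theorem measurable_qaWeightOne : Measurable qaWeightOne := by
  have hs : Measurable Real.sign := by
    have e : Real.sign = fun r : ℝ => if r < 0 then (-1:ℝ) else if 0 < r then 1 else 0 :=
      funext fun r => rfl
    rw [e]
    exact Measurable.ite measurableSet_Iio measurable_const
      (Measurable.ite measurableSet_Ioi measurable_const measurable_const)
  exact hs.mul (continuous_qaTail.measurable.comp continuous_abs.measurable)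

/-- `t ↦ F(|t|)` is integrable. [folklore] -/
theorem integrable_qaTail_abs : Integrable fun t : ℝ => qaTail |t| := by
  have h1 : IntegrableOn (fun t : ℝ => qaTail |t|) (Ioi 0) :=
    integrableOn_qaTail_Ioi.congr_fun (fun t ht => by rw [abs_of_pos (show 0 < t from ht)])
      measurableSet_Ioi
  have hF : IntegrableOn qaTail (Ici 0) := by
    rw [integrableOn_Ici_iff_integrableOn_Ioi]
    exact integrableOn_qaTail_Ioi
  have h2' : IntegrableOn (qaTail ∘ Neg.neg) (Neg.neg ⁻¹' Ici (0:ℝ)) :=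
    ((Measure.measurePreserving_neg (volume : Measure ℝ)).integrableOn_comp_preimage
      (Homeomorph.neg ℝ).measurableEmbedding).2 hF
  have hpre : Neg.neg ⁻¹' Ici (0:ℝ) = Iic 0 := by
    ext t; simp
  rw [hpre] at h2'
  have h2 : IntegrableOn (fun t : ℝ => qaTail |t|) (Iic 0) :=
    h2'.congr_fun (fun t ht => by
      show qaTail (-t) = qaTail |t|
      rw [abs_of_nonpos (show t ≤ 0 from ht)]) measurableSet_Iic
  have h := h2.union h1
  rwa [Iic_union_Ioi, integrableOn_univ] at h

/-- `W₁` is integrable. [folklore] -/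
theorem integrable_qaWeightOne : Integrable qaWeightOne :=
  integrable_qaTail_abs.abs.mono' measurable_qaWeightOne.aestronglyMeasurable
    (Eventually.of_forall fun t => by rw [Real.norm_eq_abs]; exact abs_qaWeightOne_le t)

/-- **The sine transform of `W₁`**: `∫ W₁(t) sin(νt) dt = (1 - ρ(ν/2π))/ν` (`ν ≠ 0`). [folklore] -/
theorem integral_qaWeightOne_mul_sin {ν : ℝ} (hν : ν ≠ 0) :
    ∫ t, qaWeightOne t * Real.sin (ν * t) = (1 - qaBump (ν / (2 * π))) / ν := by
  set g : ℝ → ℝ := fun x => Real.sign x ^ 2 * (qaTail x * Real.sin (ν * x)) with hg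
  have e : ∀ t : ℝ, qaWeightOne t * Real.sin (ν * t) = g |t| := by
    intro t
    rcases lt_trichotomy t 0 with h | h | h
    · simp only [hg, qaWeightOne, abs_of_neg h, Real.sign_of_neg h, Real.sign_of_pos (neg_pos.2 h),
        mul_neg, Real.sin_neg]
      ring
    · subst h; simp [hg, qaWeightOne_zero]
    · simp only [hg, qaWeightOne, abs_of_pos h, Real.sign_of_pos h]
      ring
  have e2 : ∫ x in Ioi (0:ℝ), g x = ∫ x in Ioi (0:ℝ), qaTail x * Real.sin (ν * x) :=
    setIntegral_congr_fun measurableSet_Ioi fun x hx => by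
      simp only [hg, Real.sign_of_pos (show 0 < x from hx)]
      ring
  calc ∫ t, qaWeightOne t * Real.sin (ν * t) = ∫ t, g |t| := by simp_rw [e]
    _ = 2 * ∫ x in Ioi (0:ℝ), g x := integral_comp_abs
    _ = (1 - qaBump (ν / (2 * π))) / ν := by
        rw [e2, integral_Ioi_qaTail_mul_sin hν]
        field_simp

/-- The cosine transform of the odd function `W₁` vanishes. [folklore] -/
theorem integral_qaWeightOne_mul_cos (ν : ℝ) : ∫ t, qaWeightOne t * Real.cos (ν * t) = 0 := by
  have h := integral_neg_eq_self (fun t => qaWeightOne t * Real.cos (ν * t)) volume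
  simp only [qaWeightOne_neg, mul_neg, Real.cos_neg, neg_mul, integral_neg] at h
  linarith

/-! ### The scaled weight `W_γ(t) = W₁(γ t)` -/

/-- **The quasi-adiabatic weight function at gap `γ`**: `W_γ(t) = W₁(γt)`. It is odd, bounded,
integrable with `‖W_γ‖₁ = ‖W₁‖₁/γ`, has super-polynomially small tails
`∫_{|t|>T} |W_γ| = O_n(γ⁻¹ (1 + γT)^{-n})`, and its Fourier transform is EXACTLY `i/ν` at all
frequencies `|ν| ≥ γ`: `∫ W_γ(t) e^{iνt} dt = i/ν`. These are the defining properties of the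
weight of the quasi-adiabatic (spectral-flow / Hastings) generator in Bachmann–Michalakis–
Nachtergaele–Sims, CMP 309 (2012), Assumption 2.2 with eq. (2.12) and Lemma 2.6 (their `W_γ` is
built from the kernel of their Lemma 2.3 — a different function with the same Fourier transform on
`|ν| ≥ γ` and almost-exponential decay; the present Schwartz-kernel variant has `O(T^{-∞})` tails,
which is all the `O(L^{-∞})` estimates downstream use). [folklore] -/
def qaWeight (γ t : ℝ) : ℝ := qaWeightOne (γ * t)

/-- `W_γ` is odd. [folklore] -/
theorem qaWeight_neg (γ t : ℝ) : qaWeight γ (-t) = -qaWeight γ t := by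
  rw [qaWeight, qaWeight, mul_neg, qaWeightOne_neg]

/-- `|W_γ(-t)| = |W_γ(t)|`. [folklore] -/
theorem abs_qaWeight_neg (γ t : ℝ) : |qaWeight γ (-t)| = |qaWeight γ t| := by
  rw [qaWeight_neg, abs_neg]

/-- The uniform bound `|W_γ(t)| ≤ ∫ |w|`, independent of `γ`. [folklore] -/
theorem abs_qaWeight_le (γ t : ℝ) : |qaWeight γ t| ≤ ∫ s, |qaKernel s| :=
  abs_qaWeightOne_le_integral _

/-- `W_γ` is measurable. [folklore] -/
theorem measurable_qaWeight (γ : ℝ) : Measurable (qaWeight γ) :=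
  measurable_qaWeightOne.comp (measurable_const_mul γ)

/-- `W_γ` is integrable (`γ ≠ 0`). [folklore] -/
theorem integrable_qaWeight {γ : ℝ} (hγ : γ ≠ 0) : Integrable (qaWeight γ) :=
  integrable_qaWeightOne.comp_mul_left' hγ

/-- **The sine transform of `W_γ` is exactly `1/ν` for `|ν| ≥ γ > 0`.** [folklore] -/
theorem integral_qaWeight_mul_sin {γ ν : ℝ} (hγ : 0 < γ) (hν : γ ≤ |ν|) :
    ∫ t, qaWeight γ t * Real.sin (ν * t) = 1 / ν := by
  have hν0 : ν ≠ 0 := fun h => by rw [h, abs_zero] at hν; exact absurd hν (not_le.2 hγ)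
  have h := Measure.integral_comp_mul_left (fun s => qaWeightOne s * Real.sin (ν / γ * s)) γ
  have e : ∀ t : ℝ, qaWeightOne (γ * t) * Real.sin (ν / γ * (γ * t)) = qaWeight γ t * Real.sin (ν * t) := by
    intro t
    rw [qaWeight]
    congr 2
    field_simp
  simp only [e] at h
  rw [h, integral_qaWeightOne_mul_sin (div_ne_zero hν0 hγ.ne'), qaBump_eq_zero, smul_eq_mul,
    abs_of_pos (inv_pos.2 hγ)]
  · rw [sub_zero]
    field_simp
  · rw [abs_div, abs_div, abs_of_pos hγ, abs_of_pos (by positivity : (0:ℝ) < 2 * π),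
      le_div_iff₀ (by positivity), le_div_iff₀ hγ]
    calc 1 / (2 * π) * (2 * π) * γ = γ := by field_simp
      _ ≤ |ν| := hν

/-- The cosine transform of `W_γ` vanishes. [folklore] -/
theorem integral_qaWeight_mul_cos (γ ν : ℝ) : ∫ t, qaWeight γ t * Real.cos (ν * t) = 0 := by
  have h := integral_neg_eq_self (fun t => qaWeight γ t * Real.cos (ν * t)) volume
  simp only [qaWeight_neg, mul_neg, Real.cos_neg, neg_mul, integral_neg] at h
  linarith

/-- **The Fourier transform of `W_γ` is exactly `i/ν` at frequencies `|ν| ≥ γ`**: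
`∫ W_γ(t) e^{itν} dt = i/ν`. This is the property that makes the quasi-adiabatic generator
invert `ad_H` exactly across a spectral gap `≥ γ` (BMNS 2012, eq. (2.12)). [folklore] -/
theorem integral_qaWeight_mul_cexp {γ ν : ℝ} (hγ : 0 < γ) (hν : γ ≤ |ν|) :
    ∫ t, (qaWeight γ t : ℂ) * cexp ((t * ν : ℝ) * I) = I / ν := by
  have hint := integrable_qaWeight hγ.ne'
  have hcos : Integrable fun t => qaWeight γ t * Real.cos (ν * t) :=
    hint.mul_bdd (c := 1) (by fun_prop)
      (Eventually.of_forall fun t => by simpa using Real.abs_cos_le_one (ν * t))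
  have hsin : Integrable fun t => qaWeight γ t * Real.sin (ν * t) :=
    hint.mul_bdd (c := 1) (by fun_prop)
      (Eventually.of_forall fun t => by simpa using Real.abs_sin_le_one (ν * t))
  have e : ∀ t : ℝ, (qaWeight γ t : ℂ) * cexp ((t * ν : ℝ) * I) =
      ((qaWeight γ t * Real.cos (ν * t) : ℝ) : ℂ) + ((qaWeight γ t * Real.sin (ν * t) : ℝ) : ℂ) * I := by
    intro t
    rw [Complex.exp_mul_I, ← Complex.ofReal_cos, ← Complex.ofReal_sin, mul_comm t ν]
    push_cast
    ring
  simp_rw [e]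
  rw [integral_add (f := fun t => ((qaWeight γ t * Real.cos (ν * t) : ℝ) : ℂ))
    (g := fun t => ((qaWeight γ t * Real.sin (ν * t) : ℝ) : ℂ) * I) hcos.ofReal (hsin.ofReal.mul_const I),
    integral_mul_const, integral_complex_ofReal, integral_complex_ofReal, integral_qaWeight_mul_cos,
    integral_qaWeight_mul_sin hγ hν]
  push_cast
  rw [zero_add, div_mul_eq_mul_div, one_mul]

/-! ### `L¹` norm and tails of `W_γ` -/

/-- `‖W₁‖₁`. [folklore] -/
def qaWeightL1 : ℝ := ∫ t, |qaWeightOne t|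

/-- `‖W₁‖₁ ≥ 0`. [folklore] -/
theorem qaWeightL1_nonneg : 0 ≤ qaWeightL1 := integral_nonneg fun _ => abs_nonneg _

/-- `‖W_γ‖₁ = ‖W₁‖₁ / γ`. [folklore] -/
theorem integral_abs_qaWeight {γ : ℝ} (hγ : 0 < γ) : ∫ t, |qaWeight γ t| = qaWeightL1 / γ := by
  have h := Measure.integral_comp_mul_left (fun s => |qaWeightOne s|) γ
  rw [qaWeightL1, div_eq_inv_mul, ← abs_of_pos (inv_pos.2 hγ), ← smul_eq_mul, ← h]
  rfl

/-- **Tails of `W_γ` on the right half-line**: `∫_{t>T} |W_γ(t)| dt ≤ C_n γ⁻¹ (1 + γT)^{-(n+1)}`.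
[folklore] -/
theorem integral_Ioi_abs_qaWeight_le (n : ℕ) :
    ∃ C : ℝ, 0 < C ∧ ∀ γ T : ℝ, 0 < γ → 0 ≤ T →
      ∫ t in Ioi T, |qaWeight γ t| ≤ C / (γ * (1 + γ * T) ^ (n + 1)) := by
  obtain ⟨C, hC, h⟩ := integral_Ioi_abs_qaTail_le n
  refine ⟨C, hC, fun γ T hγ hT => ?_⟩
  have h1 : ∫ t in Ioi T, |qaWeight γ t| = γ⁻¹ • ∫ s in Ioi (γ * T), |qaWeightOne s| :=
    integral_comp_mul_left_Ioi (fun s => |qaWeightOne s|) T hγ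
  have h2 : ∫ s in Ioi (γ * T), |qaWeightOne s| = ∫ s in Ioi (γ * T), |qaTail s| :=
    setIntegral_congr_fun measurableSet_Ioi fun s hs => by
      rw [qaWeightOne_of_pos (lt_of_le_of_lt (by positivity) hs)]
  rw [h1, h2, smul_eq_mul]
  have h3 := (h (γ * T) (by positivity)).2
  calc γ⁻¹ * ∫ s in Ioi (γ * T), |qaTail s| ≤ γ⁻¹ * (C / (1 + γ * T) ^ (n + 1)) := by gcongr
    _ = C / (γ * (1 + γ * T) ^ (n + 1)) := by
        field_simp

/-- Tails on the left half-line equal those on the right (`|W_γ|` is even). [folklore] -/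
theorem integral_Iic_abs_qaWeight (γ T : ℝ) :
    ∫ t in Iic (-T), |qaWeight γ t| = ∫ t in Ioi T, |qaWeight γ t| := by
  rw [← integral_comp_neg_Ioi]
  simp only [abs_qaWeight_neg]

/-- **Two-sided tails**: `∫_{|t| > T} |W_γ(t)| dt ≤ 2 C_n γ⁻¹ (1 + γT)^{-(n+1)}`. [folklore] -/
theorem integral_abs_qaWeight_tail (n : ℕ) :
    ∃ C : ℝ, 0 < C ∧ ∀ γ T : ℝ, 0 < γ → 0 ≤ T →
      ∫ t in {t : ℝ | T < |t|}, |qaWeight γ t| ≤ 2 * C / (γ * (1 + γ * T) ^ (n + 1)) := by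
  obtain ⟨C, hC, h⟩ := integral_Ioi_abs_qaWeight_le n
  refine ⟨C, hC, fun γ T hγ hT => ?_⟩
  have hset : {t : ℝ | T < |t|} = Iio (-T) ∪ Ioi T := by
    ext t
    simp only [mem_setOf_eq, mem_union, mem_Iio, mem_Ioi]
    constructor
    · intro ht
      rcases lt_or_ge t 0 with h0 | h0
      · left; rw [abs_of_neg h0] at ht; linarith
      · right; rwa [abs_of_nonneg h0] at ht
    · rintro (ht | ht)
      · rw [abs_of_neg (by linarith)]; linarith
      · rwa [abs_of_pos (hT.trans_lt ht)]
  have hint := (integrable_qaWeight hγ.ne').abs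
  have hdisj : Disjoint (Iio (-T)) (Ioi T) :=
    Disjoint.mono_left Iio_subset_Iic_self (Iic_disjoint_Ioi (by linarith))
  rw [hset, setIntegral_union hdisj measurableSet_Ioi hint.integrableOn
    hint.integrableOn, ← integral_Iic_eq_integral_Iio, integral_Iic_abs_qaWeight]
  have := h γ T hγ hT
  calc (∫ t in Ioi T, |qaWeight γ t|) + ∫ t in Ioi T, |qaWeight γ t|
      ≤ C / (γ * (1 + γ * T) ^ (n + 1)) + C / (γ * (1 + γ * T) ^ (n + 1)) := add_le_add this this
    _ = 2 * C / (γ * (1 + γ * T) ^ (n + 1)) := by ring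


/-- A fixed choice of the tail constants `C_n` of `integral_abs_qaWeight_tail`. [folklore] -/
def qaTailConst (n : ℕ) : ℝ := (integral_abs_qaWeight_tail n).choose

/-- `C_n > 0`. [folklore] -/
theorem qaTailConst_pos (n : ℕ) : 0 < qaTailConst n := (integral_abs_qaWeight_tail n).choose_spec.1

/-- **Two-sided tails with the fixed constants**:
`∫_{|t| > T} |W_γ(t)| dt ≤ 2 C_n / (γ (1 + γT)^{n+1})`. [folklore] -/
theorem integral_abs_qaWeight_tail_le (n : ℕ) {γ T : ℝ} (hγ : 0 < γ) (hT : 0 ≤ T) :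
    ∫ t in {t : ℝ | T < |t|}, |qaWeight γ t| ≤ 2 * qaTailConst n / (γ * (1 + γ * T) ^ (n + 1)) :=
  (integral_abs_qaWeight_tail n).choose_spec.2 γ T hγ hT

end Literature.MathematicalPhysics.QuantumLattice

end
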